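import Summits.CriticalPhenomena.SAWScalingLimit.Theses.SAWTotalPositivity
import Summits.CriticalPhenomena.SAWScalingLimit.Theorems.TPToTraversalBound.Negative.OptionalStoppingLR

/-!
# Dive vocabulary of the line `exit-mass-unforced-dive` for the crux `SAWTotalPositivity.TPToTraversalBound`
(stmt-CriticalPhenomena-10687; lead prover c5, crux protocol; skeleton
`Summits/CriticalPhenomena/SAWScalingLimit/Cruxes/TPToTraversalBound/Lines/exit_mass_unforced_dive.lean`,
crux-strategist planner-cstrat-stmt-CriticalPhenomena-10687-p1-0, 2026-08-17)

The crux is `BoundaryTP2 → CriticalBubbleBound → SAWTraversalBound` (the Aizenman–Burchard hypothesis (H1)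
for the chordal critical SAW on `δℤ²`).  The line files Kemppainen–Smirnov's Condition G2/G3 for the SAW as
an explicit lattice-typed seed (`UnforcedDiveBound`) and keeps the plumbing
`UnforcedDiveBound → MultiDiveBound → SAWTraversalBound`.

This file only fixes the VOCABULARY shared by the stub files of the line, VERBATIM from the registered
skeleton (so that every stub is stated over literally the same objects); NOTHING is asserted here:

* Vocabulary B (crux-plan planner of `Lines/power-law-tp2.lean`, 2026-08-16) — `rad`, `IsTraversal`,
  `HasNTrav`, `IdxAtLeast`, `InA`, `JoinedInA`, `Avoidable`, `Targets`, `DiveSet`, `TravSeq`, `ChargedSet`;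
  conditioning on a lattice prefix `η` uses the LANDED `Negative.PrefixSet` (restricted weights in the
  original domain = exact domain Markov);
* the two plumbing statements `UnforcedDiveBound` (KS Condition G2/G3 for the critical SAW, the seed) and
  `MultiDiveBound` (charged windows along a clock annulus).

The registered stubs over this vocabulary are `BoundaryTP2 → CriticalBubbleBound → CriticalExitMass →
UnforcedDiveBound`, `UnforcedDiveBound → MultiDiveBound`, `UnforcedDiveBound → MultiDiveBound →
SAWTraversalBound` (`CriticalExitMass` lives in `…TPToTraversalBoundExitMassDefs.lean`), each to be landed
in its own file importing this one.

Sources: A. Kemppainen, S. Smirnov, Ann. Probab. 45 (2017) 698–779 = arXiv:1212.6215, Def. 2.2, Conditions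
G2/G3, Prop. 3.5, Lemma 3.6 (index, unforced crossings); M. Aizenman, A. Burchard, Duke Math. J. 99 (1999)
§1.b ((H1)); N. Madras, G. Slade, *The Self-Avoiding Walk* (1993) §1.2 (domain Markov property of the SAW
weights).  Deliberately NOT here: any theorem of the line (only the two one-line inclusions `diveSet_subset_prefixSet`, `chargedSet_subset_prefixSet`).
-/

noncomputable section

open MeasureTheory Filter Topology Set Metric
open scoped NNReal ENNReal
open Literature.Probability.LatticeModels
open Literature.Probability.RandomPlanarGeometry
open Summit.CriticalPhenomena.SAWScalingLimit.Theses.SAWTotalPositivity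
open Summit.CriticalPhenomena.SAWScalingLimit.Theorems.TPToTraversalBound.Negative (PrefixSet)

namespace Summit.CriticalPhenomena.SAWScalingLimit.Theorems.TPToTraversalBound.ExitMass

/-! ## Vocabulary B — prefixes, traversals, index, avoidability, dives

Conditioning on a prefix `η : a δ ⇝ v` is done WITHOUT slit domains: the conditional weights are the
restricted weights `SAW.weight … (a δ) c (PrefixSet … η)` in the ORIGINAL domain.  A traversal of
`A(z₀,r,R)` by a lattice walk is an index segment `[i,j]` with endpoints in the closed inner disc / outside
the open outer disc (either order) and interior in the open annulus.  The INDEX of a vertex after `η` is the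
least number of traversals a past-avoiding walk from it to `b δ` must make (KS §3.2); the A-COMPONENT of an
annulus vertex is its component among non-past annulus vertices, AVOIDABLE when some past-avoiding walk from
the tip to `b δ` misses it (KS Def. 2.2); `Targets η b` = non-past vertices of finite, strictly higher index
than the tip, reachable from the tip only through a traversal inside an avoidable component; a DIVE is a
traversal of the future landing in `Targets`. -/

/-- Radial position of a site about the centre `z₀` at mesh `δ`. [folklore] -/
def rad (δ : ℝ) (z₀ : ℂ) (x : Site 2) : ℝ := dist (meshPoint δ x) z₀

/-- The segment `[i, j]` of the walk `w` TRAVERSES the annulus `A(z₀, r, R)`: `w i` lies in the closed inner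
disc and `w j` outside the open outer disc (or the reverse), and every vertex strictly between lies in the
open annulus (Kemppainen–Smirnov's "crossing", lattice form). -/
def IsTraversal {Ω : Set ℂ} (δ : ℝ) (z₀ : ℂ) (r R : ℝ) {u v : Site 2}
    (w : (discreteDomainGraph Ω δ).Walk u v) (i j : ℕ) : Prop :=
  i < j ∧ j ≤ w.length ∧
  ((rad δ z₀ (w.getVert i) ≤ r ∧ R ≤ rad δ z₀ (w.getVert j)) ∨
    (R ≤ rad δ z₀ (w.getVert i) ∧ rad δ z₀ (w.getVert j) ≤ r)) ∧
  ∀ l, i < l → l < j → r < rad δ z₀ (w.getVert l) ∧ rad δ z₀ (w.getVert l) < R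

/-- The walk `w` makes at least `n` separate traversals of `A(z₀,r,R)` (index-disjoint, in order). -/
def HasNTrav {Ω : Set ℂ} (δ : ℝ) (z₀ : ℂ) (r R : ℝ) {u v : Site 2}
    (w : (discreteDomainGraph Ω δ).Walk u v) (n : ℕ) : Prop :=
  ∃ i j : Fin n → ℕ, (∀ m, IsTraversal δ z₀ r R w (i m) (j m)) ∧
    ∀ ⦃m m' : Fin n⦄, m < m' → j m ≤ i m'

/-- `IdxAtLeast … P u b n`: every walk of `Ω_δ` from `u` to `b` that avoids the past `P` after its start
makes at least `n` traversals of `A(z₀,r,R)` ("the traversal index of `u` is `≥ n`", KS §3.2, lattice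
form). -/
def IdxAtLeast (Ω : Set ℂ) (δ : ℝ) (z₀ : ℂ) (r R : ℝ) (P : List (Site 2)) (u b : Site 2)
    (n : ℕ) : Prop :=
  ∀ w : (discreteDomainGraph Ω δ).Walk u b, (∀ x ∈ w.support.tail, x ∉ P) → HasNTrav δ z₀ r R w n

/-- A non-past vertex in the OPEN annulus. -/
def InA (δ : ℝ) (z₀ : ℂ) (r R : ℝ) (P : List (Site 2)) (x : Site 2) : Prop :=
  x ∉ P ∧ r < rad δ z₀ x ∧ rad δ z₀ x < R

/-- `x` and `y` lie in the same A-component: joined by a walk of non-past open-annulus vertices. -/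
def JoinedInA (Ω : Set ℂ) (δ : ℝ) (z₀ : ℂ) (r R : ℝ) (P : List (Site 2)) (x y : Site 2) : Prop :=
  ∃ W : (discreteDomainGraph Ω δ).Walk x y, ∀ s ∈ W.support, InA δ z₀ r R P s

/-- The A-component of `x` is AVOIDABLE from the tip `v`: some walk from `v` to `b` avoids the past and that
component after its start (KS Def. 2.2: "does not disconnect `γ(τ)` from `b` in `U_τ`", lattice form). -/
def Avoidable (Ω : Set ℂ) (δ : ℝ) (z₀ : ℂ) (r R : ℝ) (P : List (Site 2)) (v b x : Site 2) : Prop :=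
  ∃ e : (discreteDomainGraph Ω δ).Walk v b,
    ∀ y ∈ e.support.tail, y ∉ P ∧ ¬ JoinedInA Ω δ z₀ r R P y x

/-- **Targets** of the likelihood ratio after the prefix `η` (tip `v`): the non-past vertices `u` such that
(a) every past-avoiding walk `v ⇝ u` contains a traversal of `A(z₀,r,R)` whose first interior vertex lies in
an avoidable A-component, (b) the traversal index of `u` is STRICTLY larger than the tip's, and (c) the index
of `u` is finite. [folklore] -/
def Targets (Ω : Set ℂ) (δ : ℝ) (z₀ : ℂ) (r R : ℝ) {a v : Site 2}
    (η : (discreteDomainGraph Ω δ).Walk a v) (b : Site 2) : Set (Site 2) :=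
  {u | u ∉ η.support ∧
    (∀ w : (discreteDomainGraph Ω δ).Walk v u, (∀ x ∈ w.support.tail, x ∉ η.support) →
      ∃ i j, IsTraversal δ z₀ r R w i j ∧ Avoidable Ω δ z₀ r R η.support v b (w.getVert (i + 1))) ∧
    ∃ n m : ℕ, ¬ IdxAtLeast Ω δ z₀ r R η.support v b (n + 1) ∧
      IdxAtLeast Ω δ z₀ r R η.support u b (n + 1) ∧ ¬ IdxAtLeast Ω δ z₀ r R η.support u b m}

/-- **Dive event ("ever" form, KS Condition G3 strength)** after the prefix `η`: the chord extends `η` and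
SOME traversal of `A(z₀,r,R)` by its future lands in `Targets η b`. [folklore] -/
def DiveSet (Ω : Set ℂ) (δ : ℝ) (z₀ : ℂ) (r R : ℝ) {a v : Site 2}
    (η : (discreteDomainGraph Ω δ).Walk a v) (b : Site 2) : Set (SAW.DomainSAW Ω δ a b) :=
  {γ | ∃ q : (discreteDomainGraph Ω δ).Walk v b, γ.walk = η.append q ∧
      ∃ i j, IsTraversal δ z₀ r R q i j ∧ q.getVert j ∈ Targets Ω δ z₀ r R η b}

/-- The canonical sequence of the first `n` traversals of the CLOCK annulus `A(z₀,r,R)` by the future `q`: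
`E 0 = 0` and `E (m+1)` is the completion index of the first traversal that starts at or after `E m`. -/
def TravSeq {Ω : Set ℂ} (δ : ℝ) (z₀ : ℂ) (r R : ℝ) {v b : Site 2}
    (q : (discreteDomainGraph Ω δ).Walk v b) (n : ℕ) (E : ℕ → ℕ) : Prop :=
  E 0 = 0 ∧ ∀ m, m < n → ∃ i, E m ≤ i ∧ IsTraversal δ z₀ r R q i (E (m + 1)) ∧
    ∀ i' j', E m ≤ i' → IsTraversal δ z₀ r R q i' j' → E (m + 1) ≤ j'

/-- **Charged-window event.**  Clock annulus `A(z₀, rc, Rc)` with canonical traversal times `E 0 … E n`;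
`p` charges, the `k`-th judged at the clock time `E (mj k)` and carried by the annulus
`A(z₀, rch k, Rch k)`: the chord extends `η`, its future makes `n` clock traversals, and for every `k < p`
some traversal of the `k`-th charged annulus by the future after `E (mj k)` lands in the targets JUDGED AT
THAT TIME and is completed no later than the next judging time `E (mj (k+1))` (no constraint for the last
charge). [folklore] -/
def ChargedSet (Ω : Set ℂ) (δ : ℝ) (z₀ : ℂ) (rc Rc : ℝ) {a v : Site 2}
    (η : (discreteDomainGraph Ω δ).Walk a v) (b : Site 2) (n p : ℕ) (mj : ℕ → ℕ)
    (rch Rch : ℕ → ℝ) : Set (SAW.DomainSAW Ω δ a b) :=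
  {γ | ∃ (q : (discreteDomainGraph Ω δ).Walk v b) (E : ℕ → ℕ), γ.walk = η.append q ∧
      TravSeq δ z₀ rc Rc q n E ∧
      ∀ k, k < p → mj k ≤ n ∧
        ∃ i j, IsTraversal δ z₀ (rch k) (Rch k) (q.drop (E (mj k))) i j ∧
          (q.drop (E (mj k))).getVert j ∈
            Targets Ω δ z₀ (rch k) (Rch k) (η.append (q.take (E (mj k)))) b ∧
          (k + 1 < p → E (mj k) + j ≤ E (mj (k + 1)))}

/-! ## The two statements of the plumbing -/

/-- **UnforcedDiveBound — Kemppainen–Smirnov's Condition G2/G3 for the critical SAW, lattice-typed**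
(statement interface of the seed, the registered stub `stub_unforcedDive`; nothing is asserted here).  For
every Dobrushin domain, endpoint approximation and `ε > 0` there are an aspect ratio `C₀ > 2` and a mesh
ceiling `δ₀ > 0` such that for `δ ≤ δ₀`, every annulus `A(z₀,r,R)` with `δ ≤ r`, `C₀ r ≤ R` and every
self-avoiding lattice prefix `η` from `a δ`: the weight of the chords extending `η` whose future EVER makes a
dive of `A` (a traversal landing in `Targets η (b δ)`) is at most `ε` times the weight of all chords
extending `η`. -/
def UnforcedDiveBound : Prop :=
  ∀ (D : DobrushinDomain) (a b : ℝ → Site 2), SAW.IsEndpointApprox D a b → ∀ ε : ℝ, 0 < ε →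
    ∃ C₀ δ₀ : ℝ, 2 < C₀ ∧ 0 < δ₀ ∧ ∀ δ ∈ Set.Ioc (0 : ℝ) δ₀,
      ∀ (z₀ : ℂ) (r R : ℝ), δ ≤ r → C₀ * r ≤ R →
      ∀ (v : Site 2) (η : (discreteDomainGraph D.carrier δ).Walk (a δ) v), η.IsPath →
        SAW.weight D.carrier δ (a δ) (b δ) (DiveSet D.carrier δ z₀ r R η (b δ)) ≤
          ENNReal.ofReal ε * SAW.weight D.carrier δ (a δ) (b δ) (PrefixSet D.carrier δ (a δ) (b δ) η)

/-- **MultiDiveBound — charged windows along a clock annulus** (statement interface; nothing is asserted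
here).  Same `C₀(ε), δ₀(ε)`; for every clock annulus and every list of `p` charges with strictly increasing
judging indices and admissible charged annuli (`δ ≤ rch k`, `C₀ · rch k ≤ Rch k`, common centre), the
charged-window event costs `ε^p`. -/
def MultiDiveBound : Prop :=
  ∀ (D : DobrushinDomain) (a b : ℝ → Site 2), SAW.IsEndpointApprox D a b → ∀ ε : ℝ, 0 < ε →
    ∃ C₀ δ₀ : ℝ, 2 < C₀ ∧ 0 < δ₀ ∧ ∀ δ ∈ Set.Ioc (0 : ℝ) δ₀,
      ∀ (z₀ : ℂ) (rc Rc : ℝ), δ ≤ rc → C₀ * rc ≤ Rc →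
      ∀ (v : Site 2) (η : (discreteDomainGraph D.carrier δ).Walk (a δ) v), η.IsPath →
      ∀ (n p : ℕ) (mj : ℕ → ℕ) (rch Rch : ℕ → ℝ),
        (∀ k, k + 1 < p → mj k < mj (k + 1)) → (∀ k, k < p → δ ≤ rch k ∧ C₀ * rch k ≤ Rch k) →
        SAW.weight D.carrier δ (a δ) (b δ) (ChargedSet D.carrier δ z₀ rc Rc η (b δ) n p mj rch Rch) ≤
          ENNReal.ofReal ε ^ p *
            SAW.weight D.carrier δ (a δ) (b δ) (PrefixSet D.carrier δ (a δ) (b δ) η)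

/-! ## Elementary API -/

/-- A dive extends the prefix: `DiveSet … η b ⊆ PrefixSet … η` (so the seed's inequality is trivially true
with `ε = 1`, and `UnforcedDiveBound` carries content only for `ε < 1`). -/
theorem diveSet_subset_prefixSet : ∀ (Ω : Set ℂ) (δ : ℝ) (z₀ : ℂ) (r R : ℝ) {a v : Site 2}
    (η : (discreteDomainGraph Ω δ).Walk a v) (b : Site 2), DiveSet Ω δ z₀ r R η b ⊆ PrefixSet Ω δ a b η := by
  rintro Ω δ z₀ r R a v η b γ ⟨q, hq, -⟩
  exact ⟨q, hq⟩

/-- A charged-window chord extends the prefix: `ChargedSet … η b n p mj rch Rch ⊆ PrefixSet … η`. -/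
theorem chargedSet_subset_prefixSet (Ω : Set ℂ) (δ : ℝ) (z₀ : ℂ) (rc Rc : ℝ) {a v : Site 2}
    (η : (discreteDomainGraph Ω δ).Walk a v) (b : Site 2) (n p : ℕ) (mj : ℕ → ℕ)
    (rch Rch : ℕ → ℝ) :
    ChargedSet Ω δ z₀ rc Rc η b n p mj rch Rch ⊆ PrefixSet Ω δ a b η := by
  rintro γ ⟨q, E, hq, -⟩
  exact ⟨q, hq⟩

end Summit.CriticalPhenomena.SAWScalingLimit.Theorems.TPToTraversalBound.ExitMass

end
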